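import Summits.QuantumFields.YangMills.Theorems.BalabanUVNodesN11OmegaTopO3AtRecord13

/-!
# DAG node N11 — THE Ω-TOP CHILDREN AT THE RE-PINNED WITNESS `rePinH θ` (LOCATED, kernel-checked): 11a reads the generation weights at the BASE configuration, where the certificate
# family's `ζ_k(∅)` is `1 − w_k(s′^{all-large}_{k+1})(1, 1̄)` — IDENTICALLY `0` for `1 ≤ k < K` (p534515), the `V′`-INDEPENDENT constant `c₀ = 1 − w_0(s_bottom)(1, 1̄)` at `k = 0`;
# hence at `rePinH θ` the §2-form slot of EVERY child with `Ω_{k+1} = 𝕋`, `1 ≤ k < K`, is the ZERO FUNCTION (its (O3′) holds iff its 𝐓-slot vanishes a.e. on the support), and the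
# top pair's new side at the first step is `c₀ · exp A_1(𝕋,𝕋; u₁, e₁)(U_1(V′))`

HEADER — WORK-UNIT METADATA.  Cell `pub-ymgap`, YM-PLAN Track A (HUMAN RULING D-0062), seat `pub-ymgap-dag-n11-d` (g18; N11 [B14], s2), route `BalabanUVNodes`, item K1⁹ =
stmt-QuantumFields-27364 (helper lane, `--kind proof --supports 27364 --as helper`, count-neutral).  [III] = [Balaban1988Convergent], [I] = [Balaban1987RG1].  Over this seat's g18
`…N11OmegaTopTStep` ∕ `…N11TopChildTStep` (11a's `𝐓_{k+1}` at the Ω-top children), g9 `…N11HistoryPinnedResidualDefs` ∕ `…N11RePinnedParamDefs` (`ZhPinOfRecord₁₃`, `rePinH`), g7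
`…N11DiagonalPinAboveZero` (`wOfRecord_seqAllLarge_succ_eq_one`), node00-def-K0a's `Node00.Record13ResidualsR` (`ZrOfRecord₁₃`, `stepWeightPinOfRecord₁₃`), g3's `chiAW_empty_empty`.

WHY THIS FILE (a LOCATED reading, director-ym's «record other than print» class; nothing of Bałaban asserted or denied).  `…N11OmegaTopTStep` shows that at a child `s′` with
`Ω_{k+1}(s′) = 𝕋` the new side of (O3′) carries the factor `ζ_k(Ω^c_{k+1}) = ζ_k(∅)` of 11a's weights READ AT THE BASE CONFIGURATION `base_{k+1} V′` (unit gauge fields at the levels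
`≤ k`, zero fluctuation).  This seat's own A6 inhabitant `rePinH θ` (g9) pins the history-indexed residual to the certificate family `ZhPinOfRecord₁₃`, which — off the no-expansion
histories, in particular on every history with `Ω_{k+1} = 𝕋` — IS node00-def-K0a's run-indexed `ZrOfRecord₁₃`: `ζ_k(∅)(ω) = 1 − w_k(s′^{all-large}_{k+1})((ω k).1, (ω k).1‾)` (`k < K`).
At the base configuration `(ω k).1 = 1`; and g7 proved `w_k(s′^{all-large}_{k+1}) ≡ 1` for `k ≥ 1` (the all-large labels resolve unity).  So: (a) for `1 ≤ k < K` the factor is `0` at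
EVERY configuration — the §2-form slot `sect2Slot(W(s′), s′, t′, E′, U)` of every Ω-top child is the zero function whatever the supplier's terms, and its (O3′) clause holds iff its
𝐓-slot vanishes a.e. on the `χ_{k+1}`-support (on the live-selector line that is automatic: `slot_k` vanishes off the all-large history for `k ≥ 1`); (b) at `k = 0` the factor is
the `V′`-INDEPENDENT constant `c₀ = 1 − w_0(s_bottom)(1, 1̄)` (`1̄` = the average of the unit field), so the MAIN TERM's new side is `c₀ · exp A_1(𝕋, 𝕋; u₁, (∅,0), e₁)(U_1(base₁ V′))`.
In print `ζ(∅) = 1` (an empty resummation, [III] p.267); `c₀` is decided by the BOND values of def-R's classical-choice minimiser at unit data (flat by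
`plaqHol_UminOfRecord_avgFamily_one`, but a pure gauge need not be (3.3)-close to `1`) — a design point for the K-lanes ∕ node00-def-T (ζ read at the pair configuration, or `ζ_0(∅)`
pinned to `1` where the unity row allows), recorded here as kernel facts about the tree's own objects.

WHAT THIS FILE PROVES (0 `def`, 0 `sorry`, standard axioms).  §1 `baseCfg_fst_of_ne` (the base configuration's gauge field at a level `j ≠ k` is `1`) · `not_isNoExpHistAt_of_Omega_univ` ·
★ `WtOfRecord₁₃H_rePinH_ζ_empty_of_Omega_univ` (`ζ_j(∅)(ω) = 1 − stepWeightPin_j(ω)` at every history with `Ω_{j+1} = 𝕋`, `j < K`) · ★★ `WtOfRecord₁₃H_rePinH_ζ_empty_eq_zero`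
(`= 0` for `1 ≤ j < K`, ζ-unity) · ★★ `WtOfRecord₁₃H_rePinH_ζ_zero_empty_baseCfg` (`k = 0`: `= 1 − w_0(s′^{all-large}_1)(1, 1̄)`, `V′`-independent) · `WtOfRecord₁₃H_rePinH_w_univ_empty`
(`w_j(𝕋, ∅, ∅) ≡ 1`: `χ_A(∅,∅) = 1`, `quad ≡ 0`).  §2 ★★★ `sect2Slot_rePinH_eq_zero_of_Omega_univ` (`1 ≤ k < K`: the §2-form slot of every Ω-top child is the zero function) ·
★★★ `O3_rePinH_iff_ae_zero_of_Omega_univ` (its (O3′) clause ↔ «𝐓-slot `≡ 0` or `= 0` a.e. on the support») · ★★★ `sect2Slot_rePinH_top_pair_eq` (`k = 0`, top pair: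
`sect2Slot = c₀ · exp A_1(…)(U_1(base₁V′))` with `c₀ = 1 − w_0(s′^{all-large}_1)(1, 1̄)`).

HONEST FRAMING.  LOCATED kernel facts about this seat's own witness family and K0a's residual of record (count-neutral); nothing of Bałaban asserted or refuted; K1⁹'s `∃θ` untouched
(other witnesses may pin ζ otherwise); N11 NOT discharged; K1⁹ NOT closed; no registered stub touched; counts unmoved (typed 28∕28 · discharged 5∕27 · A 5∕28).  One finite `𝕋⁴_{L^K}`
programme at fixed `ε = L^{−K}` — NOT ℝ⁴, NOT OS, NOT a mass gap, NOT Clay.  No `sorry`, `axiom`, `def`, `instance`, `notation`.  Sources (SHAPE only): [III] (1.11) p.248, p.267,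
(2.18) p.257, (2.21)–(2.23) p.258, (3.2)–(3.5) p.265, (3.16) p.268, (3.20)–(3.21) p.269, (3.23)–(3.25) p.270; [I] Thm 1 p.259.
-/

noncomputable section

open MeasureTheory
open scoped BigOperators Matrix.Norms.L2Operator

namespace Summit.QuantumFields.YangMills.Theorems.BalabanUVNodesN11OmegaTopAtRePinH

open Literature.MathematicalPhysics.QuantumFieldTheory.Balaban1983to89 T4Continuum Node00 Node00.Tk B14.Eq218Concrete B14.Sect3Decomp
open BalabanUVNodesN11HistoryPinnedResidualDefs BalabanUVNodesN11RePinnedParamDefs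
open BalabanUVNodesN11DiagonalPinAboveZero (wOfRecord_seqAllLarge_succ_eq_one)
open BalabanUVNodesN11OmegaTopTStep (sect2Slot_eq_of_Omega_univ)
open BalabanUVNodesN11TopChildTStep (sect2Slot_top_eq_exp)

variable {F : T4Family} {N : ℕ} [NeZero N]

/-! ## §1. The certificate family's `ζ_j(∅)` at a history with `Ω_{j+1} = 𝕋`, and at the base configuration -/

section Zeta

variable (θ : Stage13HParams F N) (p : B12.RunParams)

omit [NeZero N] in
/-- The base configuration's gauge field at a level `j ≠ k` is the unit field. [cite: Balaban1988Convergent, (2.18) p.257 (bookkeeping)] -/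
theorem baseCfg_fst_of_ne {V : Type} [Zero V] {k j : ℕ} (hj : j ≠ k) (Vk : GaugeField (F.P p.K) k (SU N)) :
    ((baseCfg (V := V) k Vk) j).1 = fun _ => 1 := by
  funext b
  show (if h : j = k then Vk (h ▸ b) else 1) = 1
  rw [dif_neg hj]

/-- **NO no-expansion history of length `j+1` has the raw sets of a history with `Ω_{j+1} = 𝕋`.** [cite: Balaban1988Convergent, (2.18) p.257, (2.22) p.258 (bookkeeping)] -/
theorem not_isNoExpHistAt_of_Omega_univ {n j : ℕ} (s' : SeqOfRecord F θ.ν θ.τ9.M (gOfRecord₁₃ F N θ.toStage13Params p) p.K n)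
    (hΩ : s'.Ω (j + 1) = Set.univ) :
    ¬ (j < p.K ∧ ∃ s : SeqOfRecord F θ.ν θ.τ9.M (gOfRecord₁₃ F N θ.toStage13Params p) p.K (j + 1), IsNoExpHistAt (θ := θ.toStage13Params) (p := p) s'.Ω s'.Λ j s) := by
  rintro ⟨-, s, hs⟩
  have h := hs.Ω_top
  rw [hs.Ω_eq, truncWindow_of_mem (j + 1) s'.Ω (Nat.succ_pos j) le_rfl, hΩ] at h
  exact univ_ne_empty_site (F := F) p.K h

/-- ★ **AT `rePinH θ`, ON A HISTORY WITH `Ω_{j+1} = 𝕋` (`j < K`): `ζ_j(∅)(ω) = 1 − w_j(s′^{all-large}_{j+1})((ω j).1, (ω j).1‾)`** — the certificate family falls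
back to K0a's run-indexed residual there. [cite: Balaban1988Convergent, (1.11) p.248, p.267, (3.16)–(3.20) pp.268–269] -/
theorem WtOfRecord₁₃H_rePinH_ζ_empty_of_Omega_univ {n j : ℕ} (hj : j < p.K)
    (s' : SeqOfRecord F θ.ν θ.τ9.M (gOfRecord₁₃ F N θ.toStage13Params p) p.K n) (hΩ : s'.Ω (j + 1) = Set.univ) (ω : MultiCfg (F.P p.K) (SU N) (FluctV N)) :
    (WtOfRecord₁₃H F N (rePinH θ) p s').ζ j ∅ ω = 1 - stepWeightPinOfRecord₁₃ F N θ.toStage13Params p j ω := by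
  show (ZhPinOfRecord₁₃ θ.toStage13Params p s'.Ω s'.Λ).ζ0 j ∅ ω = _
  rw [ZhPinOfRecord₁₃_ζ0_of_not (not_isNoExpHistAt_of_Omega_univ θ p s' hΩ), ZrOfRecord₁₃_ζ0_empty hj]

/-- ★★ **… WHICH IS `0` FOR `1 ≤ j < K`** (ζ-unity of def-T's label residual): the all-large-field labels of an old term with `Λ_j = ∅` resolve unity, `w_j(s′^{all-large}_{j+1}) ≡ 1`
(p534515). [cite: Balaban1988Convergent, (3.2)–(3.5) p.265, (3.16) p.268, (3.20)–(3.21) p.269, p.267] -/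
theorem WtOfRecord₁₃H_rePinH_ζ_empty_eq_zero (hζu : IsZetaUnity F N θ.ν θ.τ9.M θ.ζ) {n j : ℕ} (h1 : 1 ≤ j) (hj : j < p.K)
    (s' : SeqOfRecord F θ.ν θ.τ9.M (gOfRecord₁₃ F N θ.toStage13Params p) p.K n) (hΩ : s'.Ω (j + 1) = Set.univ) (ω : MultiCfg (F.P p.K) (SU N) (FluctV N)) :
    (WtOfRecord₁₃H F N (rePinH θ) p s').ζ j ∅ ω = 0 := by
  rw [WtOfRecord₁₃H_rePinH_ζ_empty_of_Omega_univ θ p hj s' hΩ ω, sub_eq_zero]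
  exact (wOfRecord_seqAllLarge_succ_eq_one θ.ν θ.τ9.M θ.A₁ p (gOfRecord₁₃ F N θ.toStage13Params p) hζu h1 ((ω j).1)
    ((avOfRecord F N p.K j).avg (ω j).1)).symm

/-- ★★ **AT `k = 0`, READ AT 11a's BASE CONFIGURATION, THE FACTOR IS A `V′`-INDEPENDENT CONSTANT**: `ζ_0(∅)(base₁ V′) = 1 − w_0(s′^{all-large}_1)(1, 1̄)` (`0 < K`) — the base
configuration's level-`0` gauge field is the unit field. [cite: Balaban1988Convergent, (1.11) p.248, (2.18) p.257, (3.2)–(3.5) p.265] -/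
theorem WtOfRecord₁₃H_rePinH_ζ_zero_empty_baseCfg (hK : 0 < p.K) {n : ℕ}
    (s' : SeqOfRecord F θ.ν θ.τ9.M (gOfRecord₁₃ F N θ.toStage13Params p) p.K n) (hΩ : s'.Ω 1 = Set.univ) (V' : GaugeField (F.P p.K) 1 (SU N)) :
    (WtOfRecord₁₃H F N (rePinH θ) p s').ζ 0 ∅ (baseCfg (V := FluctV N) 1 V') =
      1 - wOfRecord₉ F N θ.toStage9Params p (gOfRecord₁₃ F N θ.toStage13Params p) 0
        (seqAllLargeOfRecord F θ.ν θ.τ9.M (gOfRecord₁₃ F N θ.toStage13Params p) p.K 1) (fun _ => 1) ((avOfRecord F N p.K 0).avg fun _ => 1) := by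
  rw [WtOfRecord₁₃H_rePinH_ζ_empty_of_Omega_univ θ p hK s' hΩ]
  unfold stepWeightPinOfRecord₁₃
  rw [baseCfg_fst_of_ne p (V := FluctV N) Nat.zero_ne_one V']

/-- **THE A-SIDE FACTOR OF THE EMPTY REGIONS IS `1` at `rePinH θ`**: `w_j(𝕋, ∅, ∅) ≡ 1` (`χ_A(∅, ∅) = 1`, the certificate family's `quad ≡ 0`).
[cite: Balaban1988Convergent, (2.21) p.258, (3.21) p.269, (3.23) p.270 (bookkeeping)] -/
theorem WtOfRecord₁₃H_rePinH_w_univ_empty {n : ℕ} (s' : SeqOfRecord F θ.ν θ.τ9.M (gOfRecord₁₃ F N θ.toStage13Params p) p.K n) (j : ℕ)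
    (ω : MultiCfg (F.P p.K) (SU N) (FluctV N)) : (WtOfRecord₁₃H F N (rePinH θ) p s').w j Set.univ ∅ ∅ ω = 1 := by
  show chiAW F N (FluctV N) θ.ν θ.A₁ p (gOfRecord₁₃ F N θ.toStage13Params p) j ∅ ∅ ω *
      Real.exp (-(1 / 2 : ℝ) * (ZhPinOfRecord₁₃ θ.toStage13Params p s'.Ω s'.Λ).quad j Set.univ ω) = 1
  rw [chiAW_empty_empty, ZhPinOfRecord₁₃_quad, mul_zero, Real.exp_zero, one_mul]

end Zeta

/-! ## §2. Consequences for the (O3′) clause at the Ω-top children of `rePinH θ` -/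

section Consequences

variable (θ : Stage13HParams F N) (p : B12.RunParams)

/-- ★★★ **AT `rePinH θ`, FOR `1 ≤ k < K`, THE §2-FORM SLOT OF EVERY CHILD WITH `Ω_{k+1} = 𝕋` IS THE ZERO FUNCTION** — whatever the term values, constant and background map
(every summand of `…N11OmegaTopTStep.sect2Slot_eq_of_Omega_univ` carries the factor `ζ_k(∅)(base V′) = 0`). [cite: Balaban1988Convergent, (2.18) p.257, (2.23) p.258, (3.23)–(3.25) p.270] -/
theorem sect2Slot_rePinH_eq_zero_of_Omega_univ (hζu : IsZetaUnity F N θ.ν θ.τ9.M θ.ζ) {k : ℕ} (h1 : 1 ≤ k) (hk : k < p.K)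
    (s' : SeqOfRecord F θ.ν θ.τ9.M (gOfRecord₁₃ F N θ.toStage13Params p) p.K (k + 1)) (hΩ : s'.Ω (k + 1) = Set.univ)
    (Sg : Sect2.Setting (MatA N) (SU N)) (Rz : Sect2.Residual (F.P p.K) (MatA N)) (t : Sect2.TermValues (F.P p.K) (MatA N) (FluctV N) θ.τ9.M) (E' : ℝ) (U : BgMap F N p.K) :
    sect2Slot F N (FluctV N) p.K Sg Rz (WtOfRecord₁₃H F N (rePinH θ) p s') s' t E' U = 0 := by
  classical
  funext V'
  rw [sect2Slot_eq_of_Omega_univ F N θ.ν θ.τ9 p (gOfRecord₁₃ F N θ.toStage13Params p) k Sg Rz (WtOfRecord₁₃H F N (rePinH θ) p s') s' hΩ t E' U V'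
    (hdec := fun a b => Classical.propDecidable (a = b))]
  refine Finset.sum_eq_zero fun Y _ => ?_
  rw [hΩ, Set.compl_univ, WtOfRecord₁₃H_rePinH_ζ_empty_eq_zero θ p hζu h1 hk s' hΩ, zero_mul]

/-- ★★★ **HENCE ITS (O3′) CLAUSE HOLDS IFF ITS 𝐓-SLOT VANISHES (a.e. on the support)**: at `rePinH θ`, `1 ≤ k < K`, for a child `s′` with `Ω_{k+1}(s′) = 𝕋` and the slot family of ANY
parameter `θ′` on the left: «`slotT_{k+1}(s′) = 0 ∨ ∀ᵐ V′, χ ≠ 0 → slotT_{k+1}(s′)(V′) = sect2Slot(W^{rePinH θ}(s′), …)(V′)`» ↔ «`slotT_{k+1}(s′) = 0 ∨ ∀ᵐ V′, χ ≠ 0 → slotT_{k+1}(s′)(V′) = 0`».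
(On the live-selector line the right member holds trivially for `k ≥ 1`: the old slot vanishes off the all-large history.) [cite: Balaban1988Convergent, Thm 1 p.262, (3.24)–(3.25) p.270, (2.18) p.257] -/
theorem O3_rePinH_iff_ae_zero_of_Omega_univ (hζu : IsZetaUnity F N θ.ν θ.τ9.M θ.ζ) {k : ℕ} (h1 : 1 ≤ k) (hk : k < p.K)
    (s' : SeqOfRecord F θ.ν θ.τ9.M (gOfRecord₁₃ F N θ.toStage13Params p) p.K (k + 1)) (hΩ : s'.Ω (k + 1) = Set.univ)
    (Sg : Sect2.Setting (MatA N) (SU N)) (Rz : Sect2.Residual (F.P p.K) (MatA N)) (t : Sect2.TermValues (F.P p.K) (MatA N) (FluctV N) θ.τ9.M) (E' : ℝ) (U : BgMap F N p.K)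
    (T : Density (F.P p.K) (k + 1) (SU N)) (χ : Density (F.P p.K) (k + 1) (SU N)) :
    (T = 0 ∨ ∀ᵐ V' ∂fieldMeasure (F.P p.K) (k + 1) (SU N), χ V' ≠ 0 → T V' = sect2Slot F N (FluctV N) p.K Sg Rz (WtOfRecord₁₃H F N (rePinH θ) p s') s' t E' U V') ↔
      (T = 0 ∨ ∀ᵐ V' ∂fieldMeasure (F.P p.K) (k + 1) (SU N), χ V' ≠ 0 → T V' = 0) := by
  rw [sect2Slot_rePinH_eq_zero_of_Omega_univ θ p hζu h1 hk s' hΩ Sg Rz t E' U]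
  exact Iff.rfl

/-- ★★★ **THE TOP PAIR AT THE FIRST STEP, AT `rePinH θ`: THE NEW SIDE IS `c₀ · exp A_1`** with the `V′`-INDEPENDENT constant `c₀ = 1 − w_0(s′^{all-large}_1)(1, 1̄)` (`0 < K`):
`sect2Slot(W^{rePinH θ}(s′), s′, u₁, e₁, U)(V′) = (1 − w_0(s′^{all-large}_1)(1, 1̄)) · exp A_1(s′; u₁, (∅, 0), e₁)(U(base-gauge₁ V′))` at `s′ = (𝕋, 𝕋)`.
[cite: Balaban1988Convergent, (2.18) p.257, (2.22)–(2.23) p.258, (3.2)–(3.5) p.265, (1.11) p.248; Balaban1987RG1, Thm 1 p.259] -/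
theorem sect2Slot_rePinH_top_pair_eq (hK : 0 < p.K) (s' : SeqOfRecord F θ.ν θ.τ9.M (gOfRecord₁₃ F N θ.toStage13Params p) p.K 1)
    (hΩ : s'.Ω 1 = Set.univ) (hΛ : s'.Λ 1 = Set.univ)
    (Sg : Sect2.Setting (MatA N) (SU N)) (Rz : Sect2.Residual (F.P p.K) (MatA N)) (u₁ : Sect2.TermValues (F.P p.K) (MatA N) (FluctV N) θ.τ9.M) (e₁ : ℝ) (U : BgMap F N p.K)
    (V' : GaugeField (F.P p.K) 1 (SU N)) :
    sect2Slot F N (FluctV N) p.K Sg Rz (WtOfRecord₁₃H F N (rePinH θ) p s') s' u₁ e₁ U V' =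
      (1 - wOfRecord₉ F N θ.toStage9Params p (gOfRecord₁₃ F N θ.toStage13Params p) 0
          (seqAllLargeOfRecord F θ.ν θ.τ9.M (gOfRecord₁₃ F N θ.toStage13Params p) p.K 1) (fun _ => 1) ((avOfRecord F N p.K 0).avg fun _ => 1)) *
        Real.exp ((sect2ActionDataOfRecord F N (FluctV N) p.K Sg Rz s' u₁ (fun _ => ∅, fun _ => 0) e₁).action23 1
          (U (fun j => ((baseCfg (V := FluctV N) 1 V') j).1))) := by
  rw [sect2Slot_top_eq_exp (FluctV N) p.K Sg Rz (WtOfRecord₁₃H F N (rePinH θ) p s') s' hΩ hΛ u₁ e₁ U V', Finset.prod_range_one,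
    WtOfRecord₁₃H_rePinH_ζ_zero_empty_baseCfg θ p hK s' hΩ V', WtOfRecord₁₃H_rePinH_w_univ_empty θ p s' 0, mul_one]

end Consequences

end Summit.QuantumFields.YangMills.Theorems.BalabanUVNodesN11OmegaTopAtRePinH

end
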